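import Summits.CriticalPhenomena.Ising3D.TaylorRegionCheckHybridP
import Summits.CriticalPhenomena.Ising3D.TaylorTableDecOfCertsH
import Mathlib.Tactic.Linarith
import HarnessLib

/-!
# Turnkey hybrid certificates with TABLE rows (kernel-cheap), local-product even variant, and their all-Boolean capstones
(cell `pub-ising3x`, seat recog-1 gen 11; gate (g2) — `TaylorRegionCheckHybridP` × `TaylorRegionCertsH` glue)

HONEST FRAMING: lottery ticket; floor = tightest certified 3D Ising CFT bounds; no exact-solution
claim without a proof. Island framing: certified exclusion region at stated derivative order and
assumptions; not a determination of the 3D Ising critical exponents beyond that.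

`EvenRegionDataH.checkPD`: `checkP` with the discriminant rows decided by LOCAL PRODUCTS (`rowPosDP`) instead of the
product-free enclosure test (`rowPosDE`, which is sound but weak on termwise-marginal functionals — MEASURED: `j = 0`
needs 1 053 pieces, `j ≥ 41` fails, where local products pass with ≈ 90 pieces); **`taylorEvenRegion_of_evenRegionCheckHPD`**.
Turnkey: `EvenRegionCertH.checkP/checkPD`, `OddConeRegionCertH.checkP`, `TaylorTable.evenRegion_of_evenCertHP(D)`,
`TaylorTable.oddCone_of_oddCertHP`, capstones **`boxExcluded_of_taylorTable_dec_of_certsHP`** / **`…HPD`**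
(`T.check = true → T.checkEncl = true → (T.evenCertH πE).checkP(D) = true → (T.oddCertH πO).checkP = true → BoxExcluded T.box`)
and the single Booleans `gammaCheckHP(D)`. KERNEL BUDGET (measured, vanilla Λ = 11, scale 2^64): table ≈ 13 s, X/Y/odd row
≈ 15 s, local-product discriminant piece ≈ 6 s; one declaration should stay below ≈ 100 s of kernel work (split rows into
pieces; the capstones are the specification, the proof object may be a conjunction of many small `decide`s).
Region side SUFFICIENT only. Elementary glue. [folklore]
-/

namespace Summit.CriticalPhenomena.Ising3D

open Finset Set
open Literature.Analysis.ValidatedNumerics Literature.Analysis.ValidatedNumerics.PolyMP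
open Literature.Analysis.ValidatedNumerics.NumericsMP (MI)
open Literature.MathematicalPhysics.QuantumFieldTheory.ConformalBootstrap3D

/-! ### Even check with table rows and local-product discriminant -/

namespace EvenRegionDataH

/-- `checkP` with local-product discriminant rows (`rowPosDP`). [folklore] -/
def checkPD (d : EvenRegionDataH) : Bool :=
  decide (0 < d.S) && decide (0 < d.E0) && decide (d.E1 ≤ (d.J1 : ℚ) + 1) && momLenOK d.N d.R &&
  kernelSizeOK d.S (d.cQ 0) (-1) d.sσI d.ccQ d.l d.N && kernelSizeOK d.S (d.cQ 1) (-1) d.sεI d.ccQ d.l d.N &&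
  kernelSizeOK d.S (d.cQ 3) (-1) d.sbI d.ccQ d.l d.N && kernelSizeOK d.S (d.cQ 4) 1 d.sbI d.ccQ d.l d.N &&
  decide (1 ≤ d.prmX.θhi) && decide (1 ≤ d.prmY.θhi) && decide (1 ≤ d.prmD.θhi) &&
  halfStripPos2 d.S d.TX (d.E1 - d.ccQ) d.prmX && halfStripPos2 d.S d.TY (d.E1 - d.ccQ) d.prmY &&
  halfStripPosD d.S d.TX d.TY d.TZ (d.E1 - d.ccQ) d.prmD &&
  (List.range (d.J1 + 1)).all fun j =>
    rowPosP d.S d.dPj (d.PX j) d.E0 d.E1 d.ccQ j && rowPosP d.S d.dPj (d.PY j) d.E0 d.E1 d.ccQ j &&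
      rowPosDP d.S d.dPj (d.PX j) (d.PY j) (d.PZ j) d.E0 d.E1 d.ccQ j

end EvenRegionDataH

/-- **The even region from `checkPD`** (statement of `taylorEvenRegion_of_evenRegionCheckH`). [folklore] -/
theorem taylorEvenRegion_of_evenRegionCheckHPD (d : EvenRegionDataH) (hl : d.l.Nodup) (Q : Set (ℝ × ℝ))
    (hQ : ∀ p ∈ Q, MI.mem d.S p.1 d.sσI ∧ MI.mem d.S p.2 d.sεI ∧ MI.mem d.S ((p.1 + p.2) / 2) d.sbI)
    (h : d.checkPD = true) :
    TaylorEvenRegion (taylorCrossing (1 / 2) (1 / 2) d.l.toFinset fun i ab => (d.cQ i ab : ℝ)) Q ((d.E0 : ℚ) : ℝ) := by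
  simp only [EvenRegionDataH.checkPD, Bool.and_eq_true, decide_eq_true_eq] at h
  obtain ⟨⟨⟨⟨⟨⟨⟨⟨⟨⟨⟨⟨⟨⟨hS, hE0⟩, hJ1⟩, hR⟩, hN0⟩, hN1⟩, hN3⟩, hN4⟩, hθX⟩, hθY⟩, hθD⟩, hX⟩, hY⟩, hD⟩, hrows⟩ := h
  refine taylorEvenRegion_half_of_qRegion _ _ Q _ fun p hp E j hE hj => ?_
  obtain ⟨hsσ, hsε, hsb⟩ := hQ p hp
  have hEpos : 0 < E := lt_of_lt_of_le (by exact_mod_cast hE0) hE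
  by_cases hE1 : ((d.E1 : ℚ) : ℝ) ≤ E
  · have hθ := div_mem_unit hEpos hj
    have hP : ((d.E1 - d.ccQ : ℚ) : ℝ) ≤ E - d.ccQ := by push_cast; linarith
    have eX := qSum_eq_eval2_momTable hS (d.cQ 0) (-1) hsσ d.ccQ hl hN0 hR hEpos j
    have eY := qSum_eq_eval2_momTable hS (d.cQ 1) (-1) hsε d.ccQ hl hN1 hR hEpos j
    have eZ3 := qSum_eq_eval2_momTable hS (d.cQ 3) (-1) hsb d.ccQ hl hN3 hR hEpos j
    have eZ4 := qSum_eq_eval2_momTable hS (d.cQ 4) 1 hsb d.ccQ hl hN4 hR hEpos j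
    have pX := pmem2_momTableI hS (d.cQ 0) (-1) hsσ d.ccQ d.l d.N d.R
    have pY := pmem2_momTableI hS (d.cQ 1) (-1) hsε d.ccQ d.l d.N d.R
    have pZ := pmem2_add2I (pmem2_momTableI hS (d.cQ 3) (-1) hsb d.ccQ d.l d.N d.R)
      (pmem2_momTableI hS (d.cQ 4) 1 hsb d.ccQ d.l d.N d.R)
    have vX := halfStripPos2_sound hS pX hX hP hθ.1 (hθ.2.trans (by exact_mod_cast hθX))
    have vY := halfStripPos2_sound hS pY hY hP hθ.1 (hθ.2.trans (by exact_mod_cast hθY))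
    have vD := halfStripPosD_sound hS pX pY pZ hD hP hθ.1 (hθ.2.trans (by exact_mod_cast hθD))
    rw [eval2_add2] at vD
    simp only [Rat.cast_neg, Rat.cast_one] at eX eY eZ3 eZ4
    have goalD : (qSum (fun ab => (d.cQ 3 ab : ℝ)) d.l.toFinset ((p.1 + p.2) / 2) (-1) E j +
        qSum (fun ab => (d.cQ 4 ab : ℝ)) d.l.toFinset ((p.1 + p.2) / 2) 1 E j) ^ 2 ≤
        4 * qSum (fun ab => (d.cQ 0 ab : ℝ)) d.l.toFinset p.1 (-1) E j *
          qSum (fun ab => (d.cQ 1 ab : ℝ)) d.l.toFinset p.2 (-1) E j := by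
      rw [eX, eY, eZ3, eZ4, sq]; linarith
    exact ⟨by rw [eX]; exact vX.le, by rw [eY]; exact vY.le, goalD⟩
  · have hElt : E < d.E1 := lt_of_not_ge hE1
    have hjJ : j < d.J1 + 1 := by
      have h1 : (j : ℝ) < (d.J1 : ℝ) + 1 := by
        have : ((d.E1 : ℚ) : ℝ) ≤ (d.J1 : ℝ) + 1 := by exact_mod_cast hJ1
        linarith
      exact_mod_cast h1
    have hrow := List.all_eq_true.mp hrows j (List.mem_range.mpr hjJ)
    simp only [Bool.and_eq_true] at hrow
    obtain ⟨⟨rX, rY⟩, rD⟩ := hrow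
    have pX := pmem_qRowOfTableI (pmem2_kernelPDLI_of_mem hS hsσ (d.cQ 0) (-1) d.ccQ d.l) d.N j
    have pY := pmem_qRowOfTableI (pmem2_kernelPDLI_of_mem hS hsε (d.cQ 1) (-1) d.ccQ d.l) d.N j
    have pZ := pmem_addI (pmem_qRowOfTableI (pmem2_kernelPDLI_of_mem hS hsb (d.cQ 3) (-1) d.ccQ d.l) d.N j)
      (pmem_qRowOfTableI (pmem2_kernelPDLI_of_mem hS hsb (d.cQ 4) 1 d.ccQ d.l) d.N j)
    have vX := pos_of_rowPosP hS rX pX hE hj hElt.le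
    have vY := pos_of_rowPosP hS rY pY hE hj hElt.le
    have vD := disc_of_rowPosDP hS rD pX pY pZ hE hj hElt.le
    rw [evalR_addR] at vD
    have eX := qSum_eq_evalR_qRowOfTable hS (d.cQ 0) (-1) hsσ d.ccQ hl hN0 E j
    have eY := qSum_eq_evalR_qRowOfTable hS (d.cQ 1) (-1) hsε d.ccQ hl hN1 E j
    have eZ3 := qSum_eq_evalR_qRowOfTable hS (d.cQ 3) (-1) hsb d.ccQ hl hN3 E j
    have eZ4 := qSum_eq_evalR_qRowOfTable hS (d.cQ 4) 1 hsb d.ccQ hl hN4 E j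
    simp only [Rat.cast_neg, Rat.cast_one] at eX eY eZ3 eZ4 vX vY vD
    have goalD : (qSum (fun ab => (d.cQ 3 ab : ℝ)) d.l.toFinset ((p.1 + p.2) / 2) (-1) E j +
        qSum (fun ab => (d.cQ 4 ab : ℝ)) d.l.toFinset ((p.1 + p.2) / 2) 1 E j) ^ 2 ≤
        4 * qSum (fun ab => (d.cQ 0 ab : ℝ)) d.l.toFinset p.1 (-1) E j *
          qSum (fun ab => (d.cQ 1 ab : ℝ)) d.l.toFinset p.2 (-1) E j := by
      rw [eX, eY, eZ3, eZ4, sq]; linarith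
    exact ⟨by rw [eX]; exact vX.le, by rw [eY]; exact vY.le, goalD⟩

/-! ### Turnkey certificates -/

namespace EvenRegionCertH

/-- Table rows, product-free discriminant. [folklore] -/
def checkP (c : EvenRegionCertH) : Bool := decide c.l.Nodup && c.data.checkP

/-- Table rows, local-product discriminant. [folklore] -/
def checkPD (c : EvenRegionCertH) : Bool := decide c.l.Nodup && c.data.checkPD

end EvenRegionCertH

namespace OddConeRegionCertH

/-- Table rows. [folklore] -/
def checkP (c : OddConeRegionCertH) : Bool :=
  decide (0 < c.S) && decide c.l.Nodup && decide c.lψ.Nodup &&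
  c.k1lo.ok c.S 1 2 (c.box.σlo + c.box.εlo) && c.k1hi.ok c.S 1 2 (c.box.σhi + c.box.εhi) &&
  c.k2lo.ok c.S 1 2 (c.box.εlo - c.box.σhi) && c.k2hi.ok c.S 1 2 (c.box.εhi - c.box.σlo) &&
  c.k3lo.ok c.S 2 1 (2 * c.box.εlo) && c.k3hi.ok c.S 2 1 (2 * c.box.εhi) &&
  c.data.checkP

end OddConeRegionCertH

/-- [folklore] -/
theorem taylorEvenRegion_of_certHP (c : EvenRegionCertH) (h : c.checkP = true) :
    TaylorEvenRegion (taylorCrossing (1 / 2) (1 / 2) c.l.toFinset fun i ab => (c.cQ i ab : ℝ))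
      (Icc (c.box.σlo : ℝ) c.box.σhi ×ˢ Icc (c.box.εlo : ℝ) c.box.εhi) ((c.E0 : ℚ) : ℝ) := by
  simp only [EvenRegionCertH.checkP, Bool.and_eq_true, decide_eq_true_eq] at h
  obtain ⟨hl, hd⟩ := h
  refine taylorEvenRegion_of_evenRegionCheckHP c.data hl _ (fun p hp => ?_) hd
  obtain ⟨h1, h2, h3, h4⟩ := BoxQ.bounds (B := c.box) hp
  refine ⟨mem_enclQ _ h1 h2, mem_enclQ _ h3 h4, mem_enclQ _ ?_ ?_⟩
  · push_cast; linarith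
  · push_cast; linarith

/-- [folklore] -/
theorem taylorEvenRegion_of_certHPD (c : EvenRegionCertH) (h : c.checkPD = true) :
    TaylorEvenRegion (taylorCrossing (1 / 2) (1 / 2) c.l.toFinset fun i ab => (c.cQ i ab : ℝ))
      (Icc (c.box.σlo : ℝ) c.box.σhi ×ˢ Icc (c.box.εlo : ℝ) c.box.εhi) ((c.E0 : ℚ) : ℝ) := by
  simp only [EvenRegionCertH.checkPD, Bool.and_eq_true, decide_eq_true_eq] at h
  obtain ⟨hl, hd⟩ := h
  refine taylorEvenRegion_of_evenRegionCheckHPD c.data hl _ (fun p hp => ?_) hd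
  obtain ⟨h1, h2, h3, h4⟩ := BoxQ.bounds (B := c.box) hp
  refine ⟨mem_enclQ _ h1 h2, mem_enclQ _ h3 h4, mem_enclQ _ ?_ ?_⟩
  · push_cast; linarith
  · push_cast; linarith

/-- [folklore] -/
theorem oddCone_of_certHP (c : OddConeRegionCertH) (h : c.checkP = true) :
    ∀ p ∈ Icc (c.box.σlo : ℝ) c.box.σhi ×ˢ Icc (c.box.εlo : ℝ) c.box.εhi, ∀ (E : ℝ) (j : ℕ),
      ((c.E0 : ℚ) : ℝ) ≤ E → (j : ℝ) ≤ E →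
      OddConeAt (taylorCrossing (1 / 2) (1 / 2) c.l.toFinset fun i ab => (c.cQ i ab : ℝ))
        (∑ ab ∈ c.lψ.toFinset, (c.ψQ ab : ℝ) • taylorCoeffAt (1 / 2) (1 / 2) ab) (c.κ₀Q : ℝ) p.1 p.2 E j := by
  simp only [OddConeRegionCertH.checkP, Bool.and_eq_true, decide_eq_true_eq] at h
  obtain ⟨⟨⟨⟨⟨⟨⟨⟨⟨hS, hl⟩, hlψ⟩, hk1lo⟩, hk1hi⟩, hk2lo⟩, hk2hi⟩, hk3lo⟩, hk3hi⟩, hd⟩ := h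
  refine oddCone_of_oddConeRegionCheckHP c.data hl hlψ _ (fun p hp => ?_) hd
  obtain ⟨h1, h2, h3, h4⟩ := BoxQ.bounds (B := c.box) hp
  refine ⟨mem_enclQ _ h1 h2, mem_enclQ _ (by push_cast; linarith) (by push_cast; linarith),
    mem_enclQ _ (by push_cast; linarith) (by push_cast; linarith), ?_, ?_, ?_⟩
  · exact mem_half_rpow_span hS hk1lo hk1hi (by push_cast; linarith) (by push_cast; linarith)
  · exact mem_half_rpow_span hS hk2lo hk2hi (by push_cast; linarith) (by push_cast; linarith)
  · exact mem_half_rpow_neg_span hS hk3lo hk3hi (y := 2 * p.2) (by push_cast; linarith) (by push_cast; linarith)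

namespace TaylorTable

variable (T : TaylorTable)

/-- [folklore] -/
theorem evenRegion_of_evenCertHP (π : EvenRegionParamsH) (h : (T.evenCertH π).checkP = true) :
    TaylorEvenRegion T.α T.box ((T.E₀ : ℚ) : ℝ) :=
  taylorEvenRegion_of_certHP (T.evenCertH π) h

/-- [folklore] -/
theorem evenRegion_of_evenCertHPD (π : EvenRegionParamsH) (h : (T.evenCertH π).checkPD = true) :
    TaylorEvenRegion T.α T.box ((T.E₀ : ℚ) : ℝ) :=
  taylorEvenRegion_of_certHPD (T.evenCertH π) h

/-- [folklore] -/
theorem oddCone_of_oddCertHP (π : OddConeParamsH) (h : (T.oddCertH π).checkP = true) : T.OddCone :=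
  oddCone_of_certHP (T.oddCertH π) h

/-- **All-Boolean capstone, hybrid route with table rows.** [folklore] -/
theorem boxExcluded_of_taylorTable_dec_of_certsHP (h : T.check = true) (he : T.checkEncl = true)
    (πE : EvenRegionParamsH) (hE : (T.evenCertH πE).checkP = true)
    (πO : OddConeParamsH) (hO : (T.oddCertH πO).checkP = true) : BoxExcluded T.box :=
  T.boxExcluded_of_taylorTable_dec h he (T.evenRegion_of_evenCertHP πE hE) (T.oddCone_of_oddCertHP πO hO)

/-- **All-Boolean capstone, hybrid route with table rows, local-product even discriminant.** [folklore] -/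
theorem boxExcluded_of_taylorTable_dec_of_certsHPD (h : T.check = true) (he : T.checkEncl = true)
    (πE : EvenRegionParamsH) (hE : (T.evenCertH πE).checkPD = true)
    (πO : OddConeParamsH) (hO : (T.oddCertH πO).checkP = true) : BoxExcluded T.box :=
  T.boxExcluded_of_taylorTable_dec h he (T.evenRegion_of_evenCertHPD πE hE) (T.oddCone_of_oddCertHP πO hO)

/-- The four Booleans as ONE (table rows). [folklore] -/
def gammaCheckHP (πE : EvenRegionParamsH) (πO : OddConeParamsH) : Bool :=
  T.check && T.checkEncl && (T.evenCertH πE).checkP && (T.oddCertH πO).checkP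

/-- [folklore] -/
theorem boxExcluded_of_gammaCheckHP (πE : EvenRegionParamsH) (πO : OddConeParamsH)
    (h : T.gammaCheckHP πE πO = true) : BoxExcluded T.box := by
  simp only [gammaCheckHP, Bool.and_eq_true] at h
  obtain ⟨⟨⟨h1, h2⟩, h3⟩, h4⟩ := h
  exact T.boxExcluded_of_taylorTable_dec_of_certsHP h1 h2 πE h3 πO h4

/-- The four Booleans as ONE (table rows, local-product even discriminant). [folklore] -/
def gammaCheckHPD (πE : EvenRegionParamsH) (πO : OddConeParamsH) : Bool :=
  T.check && T.checkEncl && (T.evenCertH πE).checkPD && (T.oddCertH πO).checkP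

/-- [folklore] -/
theorem boxExcluded_of_gammaCheckHPD (πE : EvenRegionParamsH) (πO : OddConeParamsH)
    (h : T.gammaCheckHPD πE πO = true) : BoxExcluded T.box := by
  simp only [gammaCheckHPD, Bool.and_eq_true] at h
  obtain ⟨⟨⟨h1, h2⟩, h3⟩, h4⟩ := h
  exact T.boxExcluded_of_taylorTable_dec_of_certsHPD h1 h2 πE h3 πO h4

end TaylorTable

/-! ### Fixtures (the tree's toy hybrid certificates through the table-row pipeline) -/

/-- [folklore] -/
theorem toyEvenRegionCertH_checkPD : toyEvenRegionCertH.checkPD = true := by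
  decide +kernel

/-- [folklore] -/
theorem toyOddConeRegionCertH_checkP : toyOddConeRegionCertH.checkP = true := by
  decide +kernel

end Summit.CriticalPhenomena.Ising3D
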